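import Summits.RiemannHypothesis.RiemannHypothesis.Theorems.GroundBartaPolarPerronFrobeniusEvenFloorPrelim
import Summits.RiemannHypothesis.RiemannHypothesis.Theorems.WeilGroundStateGroundStatesConvergeToXiEulerLagrange
import Literature.NumberTheory.LFunctions.WeilEvenGroundState
import HarnessLib

/-!
# The weak Euler–Lagrange equation of an even-sector bottom state (route
`RiemannHypothesis/GroundBarta`, rung 3 `PolarPerronFrobenius`, stmt-RiemannHypothesis-18390)

Even-sector twin of `GroundStatesConvergeToXi.groundState_eulerLagrange` (Bombieri 2000 §4
Lemma 1 / (4.2), weak form along the minimising sequence): for an even-sector bottom state `u`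
(`IsWeilEvenGroundState a u`) with its normalised EVEN minimising sequence `gₙ → u` in `L²`,
`Re Q(gₙ) → ε_ev(a)`, and every EVEN window test `h`,

  `W(gₙ ⋆ h̃) → ε_ev(a) · ∫ u h̄`.

The real polar defect `Re(W(gₙ ⋆ h̃) + W(h ⋆ g̃ₙ)) − 2ε_ev(a) Re⟨gₙ, h⟩` is the polar form of the
shifted form `Re Q − ε_ev(a)‖·‖²`, non-negative on the EVEN sector, hence bounded by
`2√q(gₙ)√q(h) → 0` (`evenFloor_abs_polar_le_even`); the test `i h` (still even) gives the imaginary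
parts.  Consequence `IsWeilEvenGroundState.exists_eulerLagrange_even`.  This is the Euler–Lagrange
input of Barta/Cauchy–Schwarz pinning statements for even bottom states (e.g. item `EvenPinning`
of the draft route `EvenThetaVisibilityPinning`).  RH-free.
References: Bombieri 2000 §4 Lemma 1, (4.2), Thm 3.
-/

set_option linter.dupNamespace false

noncomputable section

open Set MeasureTheory Filter Complex
open scoped Real Topology ComplexConjugate

namespace Summit.RiemannHypothesis.RiemannHypothesis.Theorems.PolarPerronFrobenius

open Literature.NumberTheory.LFunctions
open Summit.RiemannHypothesis.RiemannHypothesis.Theorems.GroundStatesConvergeToXi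

/-- **The real polar defect vanishes in the limit (even sector).** Let `gₙ` be `L²`-normalised
EVEN window test functions with `Re Q(gₙ) → ε_ev(a)`. Then for every EVEN window test function
`k`, `Re(W(gₙ ⋆ k̃) + W(k ⋆ g̃ₙ)) − 2 ε_ev(a) Re ∫ gₙ k̄ → 0`.
[cite: Bombieri2000Weil, §4 Lemma 1 and Thm 3 (proof)] -/
theorem evenSector_tendsto_polarDefect {a : ℝ} {g : ℕ → ℝ → ℂ}
    (hg : ∀ n, IsWeilTest (g n) ∧ tsupport (g n) ⊆ Icc (-a) a ∧ (∀ t, g n (-t) = g n t) ∧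
      ∫ t, ‖g n t‖ ^ 2 = (1 : ℝ))
    (hQ : Tendsto (fun n => (weilQuadratic (g n)).re) atTop (𝓝 (weilEvenGroundEnergy a)))
    {k : ℝ → ℂ} (hk : IsWeilTest k) (hks : tsupport k ⊆ Icc (-a) a) (hke : ∀ t, k (-t) = k t) :
    Tendsto (fun n => (weilFunctional (weilConv (g n) (weilReflect k)) +
        weilFunctional (weilConv k (weilReflect (g n)))).re -
      2 * weilEvenGroundEnergy a * (∫ t, g n t * conj (k t)).re) atTop (𝓝 0) := by
  -- adapted from `GroundStatesConvergeToXi.tendsto_polarDefect_of_minimizingSeq`, ε ↦ ε_ev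
  set ε := weilEvenGroundEnergy a with hε
  have hq : Tendsto (fun n => (weilQuadratic (g n)).re - ε * ∫ t, ‖g n t‖ ^ 2) atTop (𝓝 0) := by
    have hfun : (fun n => (weilQuadratic (g n)).re - ε * ∫ t, ‖g n t‖ ^ 2) =
        fun n => (weilQuadratic (g n)).re - ε := by
      funext n
      rw [(hg n).2.2.2, mul_one]
    rw [hfun]
    have := hQ.sub_const ε
    rwa [sub_self] at this
  set qk : ℝ := (weilQuadratic k).re - ε * ∫ t, ‖k t‖ ^ 2 with hqk
  have hbound : ∀ n, |(weilFunctional (weilConv (g n) (weilReflect k)) +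
        weilFunctional (weilConv k (weilReflect (g n)))).re -
      2 * ε * (∫ t, g n t * conj (k t)).re| ≤
      2 * Real.sqrt ((weilQuadratic (g n)).re - ε * ∫ t, ‖g n t‖ ^ 2) * Real.sqrt qk := by
    intro n
    have hcs := evenFloor_abs_polar_le_even (hg n).1 (hg n).2.1 (hg n).2.2.1 hk hks hke
    have e1 := ConnesVanSuijlekom.re_weilQuadratic_add_real_mul (hg n).1 hk 1
    have e2 := ConnesVanSuijlekom.integral_norm_sq_add_real_mul (hg n).1 hk 1
    have hone : (g n + fun x => ((1 : ℝ) : ℂ) * k x) = g n + k := by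
      funext x
      simp
    rw [hone] at e1 e2
    have key : ((weilQuadratic (g n + k)).re - ε * ∫ x, ‖(g n + k) x‖ ^ 2) -
        ((weilQuadratic (g n)).re - ε * ∫ x, ‖g n x‖ ^ 2) -
        ((weilQuadratic k).re - ε * ∫ x, ‖k x‖ ^ 2) =
        (weilFunctional (weilConv (g n) (weilReflect k)) +
            weilFunctional (weilConv k (weilReflect (g n)))).re -
          2 * ε * (∫ t, g n t * conj (k t)).re := by
      rw [e1, e2]
      ring
    rw [← key]
    exact hcs
  have hsq : Tendsto (fun n => 2 * Real.sqrt ((weilQuadratic (g n)).re - ε * ∫ t, ‖g n t‖ ^ 2) *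
      Real.sqrt qk) atTop (𝓝 0) := by
    have := (hq.sqrt.const_mul 2).mul_const (Real.sqrt qk)
    simpa using this
  exact squeeze_zero_norm (fun n => by rw [Real.norm_eq_abs]; exact hbound n) hsq

/-- **Weak Euler–Lagrange equation in the even sector.** Let `gₙ` be `L²`-normalised EVEN test
functions on the window `[-a, a]` with `Re Q(gₙ) → ε_ev(a)` converging in `L²` to `u ∈ L²` (the
data of `IsWeilEvenGroundState a u`). Then for every EVEN test function `h` supported in the window,
`W(gₙ ⋆ h̃) → ε_ev(a) · ∫ u h̄`. [cite: Bombieri2000Weil, §4 Lemma 1, (4.2)] -/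
theorem evenSector_eulerLagrange {a : ℝ} {u : ℝ → ℂ} {g : ℕ → ℝ → ℂ}
    (hg : ∀ n, IsWeilTest (g n) ∧ tsupport (g n) ⊆ Icc (-a) a ∧ (∀ t, g n (-t) = g n t) ∧
      ∫ t, ‖g n t‖ ^ 2 = (1 : ℝ))
    (hQ : Tendsto (fun n => (weilQuadratic (g n)).re) atTop (𝓝 (weilEvenGroundEnergy a)))
    (hu : MemLp u 2) (hL : Tendsto (fun n => ∫ t, ‖g n t - u t‖ ^ 2) atTop (𝓝 0))
    {h : ℝ → ℂ} (hh : IsWeilTest h) (hhs : tsupport h ⊆ Icc (-a) a) (hhe : ∀ t, h (-t) = h t) :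
    Tendsto (fun n => weilFunctional (weilConv (g n) (weilReflect h))) atTop
      (𝓝 ((weilEvenGroundEnergy a : ℂ) * ∫ t, u t * conj (h t))) := by
  -- adapted from `GroundStatesConvergeToXi.groundState_eulerLagrange`, ε ↦ ε_ev
  set ε := weilEvenGroundEnergy a with hε
  set A : ℕ → ℂ := fun n => weilFunctional (weilConv (g n) (weilReflect h)) with hA
  set P : ℕ → ℂ := fun n => ∫ t, g n t * conj (h t) with hP
  have hre : Tendsto (fun n => (A n).re - ε * (P n).re) atTop (𝓝 0) := by
    have h1 := evenSector_tendsto_polarDefect hg hQ hh hhs hhe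
    have hfun : (fun n => (weilFunctional (weilConv (g n) (weilReflect h)) +
        weilFunctional (weilConv h (weilReflect (g n)))).re -
        2 * weilEvenGroundEnergy a * (∫ t, g n t * conj (h t)).re) =
        fun n => 2 * ((A n).re - ε * (P n).re) := by
      funext n
      rw [weilFunctional_weilConv_weilReflect_swap (g n) h]
      simp only [hA, hP, Complex.add_re, Complex.conj_re]
      ring
    rw [hfun] at h1
    have h2 := h1.const_mul (1 / 2 : ℝ)
    simpa using h2
  have him : Tendsto (fun n => (A n).im - ε * (P n).im) atTop (𝓝 0) := by
    have hIh : IsWeilTest fun t => I * h t := hh.const_mul I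
    have hIhs : tsupport (fun t => I * h t) ⊆ Icc (-a) a := tsupport_mul_subset_right.trans hhs
    have hIhe : ∀ t, I * h (-t) = I * h t := fun t => by rw [hhe]
    have h1 := evenSector_tendsto_polarDefect hg hQ hIh hIhs hIhe
    have hfun : (fun n => (weilFunctional (weilConv (g n) (weilReflect fun t => I * h t)) +
        weilFunctional (weilConv (fun t => I * h t) (weilReflect (g n)))).re -
        2 * weilEvenGroundEnergy a * (∫ t, g n t * conj (I * h t)).re) =
        fun n => 2 * ((A n).im - ε * (P n).im) := by
      funext n
      rw [weilFunctional_weilConv_weilReflect_swap (g n) (fun t => I * h t),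
        weilFunctional_weilConv_weilReflect_I_mul, integral_mul_conj_I_mul]
      simp only [hA, hP, Complex.add_re, Complex.conj_re, Complex.mul_re, Complex.neg_re,
        Complex.neg_im, Complex.I_re, Complex.I_im]
      ring
    rw [hfun] at h1
    have h2 := h1.const_mul (1 / 2 : ℝ)
    simpa using h2
  have hD : Tendsto (fun n => A n - (ε : ℂ) * P n) atTop (𝓝 0) := by
    refine squeeze_zero_norm (fun n => Complex.norm_le_abs_re_add_abs_im _) ?_
    have h3 := hre.abs.add him.abs
    simp only [abs_zero, add_zero] at h3
    refine h3.congr fun n => ?_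
    simp only [Complex.sub_re, Complex.sub_im, Complex.re_ofReal_mul, Complex.im_ofReal_mul]
  have hPlim : Tendsto P atTop (𝓝 (∫ t, u t * conj (h t))) := by
    have h4 := ConnesVanSuijlekom.tendsto_integral_mul_conj (ConnesVanSuijlekom.isWeilTest_memLp hh)
      hu (fun m => ConnesVanSuijlekom.isWeilTest_memLp (hg m).1) hL
    have h5 := (Complex.continuous_conj.tendsto _).comp h4
    have hconj : ∀ v : ℝ → ℂ, conj (∫ t, h t * conj (v t)) = ∫ t, v t * conj (h t) := by
      intro v
      rw [← integral_conj]
      congr 1 with t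
      simp only [map_mul, Complex.conj_conj]
      exact mul_comm _ _
    have h6 : (fun m => conj (∫ t, h t * conj (g m t))) = P := by
      funext m
      exact hconj (g m)
    rw [Function.comp_def, h6, hconj u] at h5
    exact h5
  have hsum := hD.add (hPlim.const_mul (ε : ℂ))
  rw [zero_add] at hsum
  refine hsum.congr fun n => ?_
  simp only [hA, hP]
  ring

/-- **Weak Euler–Lagrange equation, `IsWeilEvenGroundState` form.**  Every even-sector bottom
state `u` at window `a` comes with a normalised EVEN minimising sequence `gₙ → u` in `L²` along
which `W(gₙ ⋆ h̃) → ε_ev(a) ∫ u h̄` for every EVEN window test function `h`.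
[cite: Bombieri2000Weil, §4 Lemma 1, (4.2)] -/
theorem _root_.Literature.NumberTheory.LFunctions.IsWeilEvenGroundState.exists_eulerLagrange_even
    {a : ℝ} {u : ℝ → ℂ} (hu : IsWeilEvenGroundState a u) :
    ∃ g : ℕ → ℝ → ℂ,
      (∀ n, IsWeilTest (g n) ∧ tsupport (g n) ⊆ Icc (-a) a ∧ (∀ t, g n (-t) = g n t) ∧
        ∫ t, ‖g n t‖ ^ 2 = (1 : ℝ)) ∧
      Tendsto (fun n => (weilQuadratic (g n)).re) atTop (𝓝 (weilEvenGroundEnergy a)) ∧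
      Tendsto (fun n => ∫ t, ‖g n t - u t‖ ^ 2) atTop (𝓝 0) ∧
      ∀ h : ℝ → ℂ, IsWeilTest h → tsupport h ⊆ Icc (-a) a → (∀ t, h (-t) = h t) →
        Tendsto (fun n => weilFunctional (weilConv (g n) (weilReflect h))) atTop
          (𝓝 ((weilEvenGroundEnergy a : ℂ) * ∫ t, u t * conj (h t))) := by
  obtain ⟨g, hg, hQ, hL⟩ := hu.exists_tendsto
  exact ⟨g, hg, hQ, hL, fun h hh hhs hhe => evenSector_eulerLagrange hg hQ hu.memLp hL hh hhs hhe⟩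

/-- **Pinning by Cauchy–Schwarz in the even sector** (the `L²`-representer form): if `u` is an
even-sector bottom state at `a` and the polarised functional `g ↦ W(g ⋆ h̃)` of an EVEN window test
`h` is bounded on the normalised even minimising sequence by `B` in norm, eventually, then
`|ε_ev(a)| · ‖∫ u h̄‖ ≤ B`. [folklore] -/
theorem evenSector_abs_energy_mul_norm_inner_le {a : ℝ} {u : ℝ → ℂ} {g : ℕ → ℝ → ℂ}
    (hg : ∀ n, IsWeilTest (g n) ∧ tsupport (g n) ⊆ Icc (-a) a ∧ (∀ t, g n (-t) = g n t) ∧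
      ∫ t, ‖g n t‖ ^ 2 = (1 : ℝ))
    (hQ : Tendsto (fun n => (weilQuadratic (g n)).re) atTop (𝓝 (weilEvenGroundEnergy a)))
    (hu : MemLp u 2) (hL : Tendsto (fun n => ∫ t, ‖g n t - u t‖ ^ 2) atTop (𝓝 0))
    {h : ℝ → ℂ} (hh : IsWeilTest h) (hhs : tsupport h ⊆ Icc (-a) a) (hhe : ∀ t, h (-t) = h t)
    {B : ℝ} (hB : ∀ᶠ n in atTop, ‖weilFunctional (weilConv (g n) (weilReflect h))‖ ≤ B) :
    |weilEvenGroundEnergy a| * ‖∫ t, u t * conj (h t)‖ ≤ B := by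
  have hlim := evenSector_eulerLagrange hg hQ hu hL hh hhs hhe
  have h1 := le_of_tendsto ((continuous_norm.tendsto _).comp hlim) hB
  simpa [norm_mul, Complex.norm_real, Real.norm_eq_abs] using h1

end Summit.RiemannHypothesis.RiemannHypothesis.Theorems.PolarPerronFrobenius

end
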